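import Mathlib.RepresentationTheory.Homological.GroupCohomology.LowDegree
import HarnessLib

/-!
# Venture HSemireg — the AVERAGING trick: 1- and 2-cocycles of a FINITE group with values in a module on
# which `|G|` is invertible are coboundaries (the two vanishings used in COR V^tw's equivariant-lifting step)

HONEST FRAMING. Two textbook identities of finite-group cohomology («`H¹(G, V) = 0` and `H²(G, V) = 0` when
`|G|` is invertible on `V`»), proved by the explicit averaging formulae, for Mathlib's function-level predicates
`groupCohomology.IsCocycle₁/₂` and `IsCoboundary₁/₂`. No variety, no sheaf, no semiregularity map is touched;
nothing here says that HC, HC_CM or HC_AV holds, and nothing here is a new case of anything.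

## The step being served

`run/shared/lean/pub/pub-hsemireg/widen/W1/COR-VTW-DERIVATION-tw2.md` (w1-tw-2 gen 2), step (D3) «AVERAGING»:
(i) the set of flat extensions of an equivariant sheaf over an infinitesimal thickening is a torsor under a
vector space `T` with an AFFINE `G`-action, and an affine action of a finite group on a torsor under a
uniquely divisible module has a fixed point — i.e. the 1-cocycle `g ↦ g·p₀ − p₀` is a coboundary
(`isCoboundary₁_of_isCocycle₁`); (ii) the lifted isomorphisms satisfy the cocycle condition up to a 2-cocycle
with values in the abelian, uniquely divisible group `U`, which is a coboundary (`isCoboundary₂_of_isCocycle₂`),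
so they can be corrected to a genuine linearisation. Both with `k = ℚ` (or `ℂ`) and `⅟|G|` available.

## Contents (namespace `Summit.Ventures.HSemireg.FiniteGroupCocycleAveraging`)

* `sum_smul_apply_of_isCocycle₁` — for a 1-cocycle `f`: `∑_h g • f h = ∑_h f h − |G| • f g`.
* `isCoboundary₁_of_isCocycle₁` — **every 1-cocycle is a 1-coboundary**, witness `x = −⅟|G| • ∑_h f h`.
* `sum_smul_apply_of_isCocycle₂` — for a 2-cocycle `f`: `∑_j g • f (h, j) = ∑_j f (g h, j) + |G| • f (g, h) − ∑_j f (g, j)`.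
* `isCoboundary₂_of_isCocycle₂` — **every 2-cocycle is a 2-coboundary**, witness `x g = ⅟|G| • ∑_j f (g, j)`.

References (printed form; nothing below is used in the proofs): K. S. Brown, *Cohomology of Groups*, III.10
(Cor. 10.2: `|G| · Hⁿ(G, M) = 0` for `n > 0`); C. A. Weibel, *An Introduction to Homological Algebra*, 6.5.8.
-/

namespace Summit.Ventures.HSemireg.FiniteGroupCocycleAveraging

open groupCohomology Finset

variable {k : Type*} [CommRing k] {G : Type*} [Group G] [Fintype G]
  {A : Type*} [AddCommGroup A] [Module k A] [DistribMulAction G A] [SMulCommClass G k A]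

omit [SMulCommClass G k A] in
/-- For a 1-cocycle `f` (`f (g h) = g • f h + f g`) of a finite group: `∑_h g • f h = ∑_h f h − |G| • f g`
(reindex `h ↦ g h`). [folklore] -/
theorem sum_smul_apply_of_isCocycle₁ {f : G → A} (hf : IsCocycle₁ f) (g : G) :
    ∑ h, g • f h = ∑ h, f h - (Fintype.card G : k) • f g := by
  have h1 : ∀ h, g • f h = f (g * h) - f g := fun h => by
    rw [hf g h]; abel
  simp_rw [h1, Finset.sum_sub_distrib]
  have hre : ∑ h, f (g * h) = ∑ h, f h :=
    Fintype.sum_equiv (Equiv.mulLeft g) (fun h => f (g * h)) f (fun _ => rfl)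
  rw [hre, Finset.sum_const, Finset.card_univ, Nat.cast_smul_eq_nsmul]

/-- **`H¹ = 0` by averaging.** If `|G|` is invertible in `k`, every 1-cocycle `f : G → A` with values in a
`k`-module `A` carrying a commuting `G`-action is a 1-coboundary: `g • x − x = f g` for `x = −⅟|G| • ∑_h f h`.
[folklore; Brown III.10.2] -/
theorem isCoboundary₁_of_isCocycle₁ [Invertible (Fintype.card G : k)] {f : G → A} (hf : IsCocycle₁ f) :
    IsCoboundary₁ f := by
  refine ⟨-(⅟(Fintype.card G : k) • ∑ h, f h), fun g => ?_⟩
  have hsum : g • ∑ h, f h = ∑ h, f h - (Fintype.card G : k) • f g := by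
    rw [Finset.smul_sum]; exact sum_smul_apply_of_isCocycle₁ hf g
  rw [smul_neg, smul_comm g (⅟(Fintype.card G : k)) (∑ h, f h), hsum, smul_sub, smul_smul, invOf_mul_self,
    one_smul]
  abel

omit [SMulCommClass G k A] in
/-- For a 2-cocycle `f` (`f (g h, j) + f (g, h) = g • f (h, j) + f (g, h j)`) of a finite group:
`∑_j g • f (h, j) = ∑_j f (g h, j) + |G| • f (g, h) − ∑_j f (g, j)` (reindex `j ↦ h j` in the last sum). [folklore] -/
theorem sum_smul_apply_of_isCocycle₂ {f : G × G → A} (hf : IsCocycle₂ f) (g h : G) :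
    ∑ j, g • f (h, j) = ∑ j, f (g * h, j) + (Fintype.card G : k) • f (g, h) - ∑ j, f (g, j) := by
  have h1 : ∀ j, g • f (h, j) = f (g * h, j) + f (g, h) - f (g, h * j) := fun j => by
    rw [eq_sub_iff_add_eq]; exact (hf g h j).symm
  simp_rw [h1, Finset.sum_sub_distrib, Finset.sum_add_distrib]
  have hre : ∑ j, f (g, h * j) = ∑ j, f (g, j) :=
    Fintype.sum_equiv (Equiv.mulLeft h) (fun j => f (g, h * j)) (fun j => f (g, j)) (fun _ => rfl)
  rw [hre, Finset.sum_const, Finset.card_univ, Nat.cast_smul_eq_nsmul]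

/-- **`H² = 0` by averaging.** If `|G|` is invertible in `k`, every 2-cocycle `f : G × G → A` is a
2-coboundary: `g • x h − x (g h) + x g = f (g, h)` for `x g = ⅟|G| • ∑_j f (g, j)`. [folklore; Brown III.10.2] -/
theorem isCoboundary₂_of_isCocycle₂ [Invertible (Fintype.card G : k)] {f : G × G → A} (hf : IsCocycle₂ f) :
    IsCoboundary₂ f := by
  refine ⟨fun g => ⅟(Fintype.card G : k) • ∑ j, f (g, j), fun g h => ?_⟩
  have hsum : g • ∑ j, f (h, j) = ∑ j, f (g * h, j) + (Fintype.card G : k) • f (g, h) - ∑ j, f (g, j) := by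
    rw [Finset.smul_sum]; exact sum_smul_apply_of_isCocycle₂ hf g h
  simp only
  rw [smul_comm g (⅟(Fintype.card G : k)) (∑ j, f (h, j)), hsum, smul_sub, smul_add, smul_smul,
    invOf_mul_self, one_smul]
  abel

end Summit.Ventures.HSemireg.FiniteGroupCocycleAveraging
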